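import Summits.AnomalousDissipation.AnomalousDissipation.Theorems.SawtoothPulseCascadeK1LocalisedCascadeAxisKernel

/-!
# K1loc, line `Spectral` / thin start — helper: LATTICE CUT-OFFS OF CIRCLE FUNCTIONS AND THE ARC-CHARACTER LEMMA (S-D step)

Helper file of the prover lane on the crux `K1LocalisedCascade` (stmt-AnomalousDissipation-19491), route
`SawtoothPulseCascade` (S-D fibre ledger, brick B-3a).  The window lemma (`…FibreWindow`) splits the chirp `g_n` of a fibre
into `g^mid + g^rest` with `g^rest` spectrally separated from the window and `g^mid` pointwise small off the corner zones.  For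
a finitely supported lattice symbol `ψ` with kernel `k_ψ = Σ ψ(m)e_{−m}` (`…AxisKernel`) the natural `g^mid` is the circle cut-off
`(ψ ⋆ g)(y) = ∫_T k_ψ(s) g(y + s) ds`:
* `fourierCoeff_circleCutoff` — its coefficients are `ψ(m)·ĝ(m)` (so `g − ψ ⋆ g` has NO coefficient where `ψ = 1`: the exact
  separation of the window lemma);
* `norm_circleCutoff_le` — `|ψ ⋆ g(y)| ≤ (∫|k_ψ|)·sup|g|` everywhere;
* `norm_circleCutoff_le_of_char` — **the arc-character lemma**: if `|g| ≤ 1`, `g(y + s) = g(y)·e_λ(s)` for `‖s‖ < d` (on the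
  `d`-arc around `y` the function IS the character `e_λ`, as the exact-sawtooth chirp `e^{−2πi nγU⁰_j}` is on each linear piece
  when `γ ∈ ℕ`) and `ψ(λ)… = 0` in the form `Σ ψ(m)[m = λ] = 0`, then `|ψ ⋆ g(y)| ≤ 2 ∫_{‖s‖ ≥ d} |k_ψ|` — orthogonality of characters
  kills the near part, the kernel tail (`…AxisKernel.setIntegral_norm_trigPoly_le`) pays the rest.
No definitions; no statement about the crux. [cite: Grafakos2014, Prop. 3.1.2 (5) and §3.1.3] [problem: turb]
-/

-- `Summit.<Summit>.<Problem>`: single-conjunct summit, the duplicate namespace segment is deliberate.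
set_option linter.dupNamespace false

noncomputable section

namespace Summit.AnomalousDissipation.AnomalousDissipation.Theorems.SawtoothPulseCascade.K1Window

open MeasureTheory Set Filter Topology Function Complex
open Summit.AnomalousDissipation.AnomalousDissipation.Theorems.SawtoothPulseCascade.K1Start

/-! ## §1 The circle cut-off `ψ ⋆ g` and its coefficients -/

/-- Continuity of the translated integrand family `(y, s) ↦ k(s)·g(y + s)` and of the cut-off `y ↦ ∫ k(s)g(y+s)ds`. [folklore] -/
theorem continuous_circleCutoff {k g : UnitAddCircle → ℂ} (hk : Continuous k) (hg : Continuous g) :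
    Continuous fun y : UnitAddCircle => ∫ s : UnitAddCircle, k s * g (y + s) := by
  have hF : Continuous (uncurry fun (y : UnitAddCircle) (s : UnitAddCircle) => k s * g (y + s)) :=
    (hk.comp continuous_snd).mul (hg.comp (continuous_fst.add continuous_snd))
  have h := continuous_parametric_integral_of_continuous (μ := (volume : Measure UnitAddCircle)) hF isCompact_univ
  simpa only [Measure.restrict_univ] using h

/-- Translation rule for circle coefficients: `∫_T e_{−m}(y) g(y + s) dy = e_m(s)·ĝ(m)`. [cite: Grafakos2014, Prop. 3.1.2 (5)] -/
theorem integral_fourier_neg_mul_translate (g : UnitAddCircle → ℂ) (m : ℤ) (s : UnitAddCircle) :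
    ∫ y : UnitAddCircle, (fourier (-m) y : ℂ) * g (y + s) = fourier m s * fourierCoeff g m := by
  have hms : (fourier m s : ℂ) * fourier (-m) s = 1 := by
    rw [← fourier_add, show m + -m = 0 by ring]; simp
  have h1 : ∀ y : UnitAddCircle, (fourier (-m) y : ℂ) * g (y + s) = fourier m s * ((fourier (-m) (y + s) : ℂ) * g (y + s)) := by
    intro y
    rw [fourier_apply_add (-m) y s]
    linear_combination (-(fourier (-m) y : ℂ) * g (y + s)) * hms
  simp_rw [h1]
  rw [integral_const_mul]
  congr 1
  have htr := integral_add_right_eq_self (μ := (volume : Measure UnitAddCircle))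
    (fun y : UnitAddCircle => (fourier (-m) y : ℂ) * g y) s
  rw [htr, fourierCoeff.eq_1, Literature.Analysis.FunctionSpaces.Torus.volume_unitAddCircle_eq_haar]
  simp only [smul_eq_mul]

/-- **Coefficients of the circle cut-off**: for continuous `g` and `ψ` vanishing off the finite set `S`,
`fourierCoeff (y ↦ ∫_T k_ψ(s) g(y + s) ds) m = ψ(m)·ĝ(m)`, `k_ψ = Σ_{m∈S} ψ(m)e_{−m}`. [cite: Grafakos2014, Prop. 3.1.2 (5)] -/
theorem fourierCoeff_circleCutoff {g : UnitAddCircle → ℂ} (hg : Continuous g) {ψ : ℤ → ℂ} {S : Finset ℤ}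
    (hψ : ∀ m, m ∉ S → ψ m = 0) (m : ℤ) :
    fourierCoeff (fun y : UnitAddCircle => ∫ s : UnitAddCircle, (∑ l ∈ S, ψ l * fourier (-l) s) * g (y + s)) m =
      ψ m * fourierCoeff g m := by
  classical
  have hkc : Continuous fun s : UnitAddCircle => ∑ l ∈ S, ψ l * fourier (-l) s :=
    continuous_finsetSum _ fun l _ => continuous_const.mul (fourier (-l)).continuous
  -- unfold the outer coefficient as a `volume` integral
  rw [fourierCoeff.eq_1, ← Literature.Analysis.FunctionSpaces.Torus.volume_unitAddCircle_eq_haar]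
  simp_rw [smul_eq_mul]
  -- Fubini
  have hF : Continuous (uncurry fun (y : UnitAddCircle) (s : UnitAddCircle) =>
      (fourier (-m) y : ℂ) * ((∑ l ∈ S, ψ l * fourier (-l) s) * g (y + s))) :=
    ((fourier (-m)).continuous.comp continuous_fst).mul
      ((hkc.comp continuous_snd).mul (hg.comp (continuous_fst.add continuous_snd)))
  have hint : Integrable (uncurry fun (y : UnitAddCircle) (s : UnitAddCircle) =>
      (fourier (-m) y : ℂ) * ((∑ l ∈ S, ψ l * fourier (-l) s) * g (y + s)))
      ((volume : Measure UnitAddCircle).prod volume) :=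
    hF.integrable_of_hasCompactSupport (HasCompactSupport.of_compactSpace _)
  simp_rw [← integral_const_mul]
  rw [integral_integral_swap hint]
  -- inner integral in `y`
  have hinner : ∀ s : UnitAddCircle, ∫ y : UnitAddCircle, (fourier (-m) y : ℂ) * ((∑ l ∈ S, ψ l * fourier (-l) s) * g (y + s)) =
      (∑ l ∈ S, ψ l * fourier (-l) s) * (fourier m s * fourierCoeff g m) := by
    intro s
    rw [← integral_fourier_neg_mul_translate g m s, ← integral_const_mul]
    refine integral_congr_ae (Eventually.of_forall fun y => by ring)
  simp_rw [hinner]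
  -- the character sum against `e_m`
  have h2 : ∀ s : UnitAddCircle, (∑ l ∈ S, ψ l * fourier (-l) s) * ((fourier m s : ℂ) * fourierCoeff g m) =
      fourierCoeff g m * ∑ l ∈ S, ψ l * ((fourier m s : ℂ) * fourier (-l) s) := by
    intro s; rw [Finset.sum_mul, Finset.mul_sum]; exact Finset.sum_congr rfl fun l _ => by ring
  simp_rw [h2]
  rw [integral_const_mul, integral_finsetSum _ fun l _ => ?_]
  · simp_rw [integral_const_mul, integral_fourier_mul_fourier_neg]
    by_cases hm : m ∈ S
    · rw [Finset.sum_eq_single_of_mem m hm fun l _ hl => by rw [if_neg (Ne.symm hl), mul_zero], if_pos rfl, mul_one,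
        mul_comm]
    · rw [Finset.sum_eq_zero fun l hl => by rw [if_neg (fun h : m = l => hm (h ▸ hl)), mul_zero], hψ m hm, zero_mul,
        mul_zero]
  · exact (continuous_const.mul ((fourier m).continuous.mul (fourier (-l)).continuous)).integrable_of_hasCompactSupport
      (HasCompactSupport.of_compactSpace _)

/-! ## §2 Pointwise bounds: everywhere, and on an arc where `g` is a character (orthogonality + kernel tail) -/

/-- `|∫ k(s) g(y+s) ds| ≤ (∫|k|)·B` for `|g| ≤ B`. [folklore] -/
theorem norm_circleCutoff_le {k g : UnitAddCircle → ℂ} (hk : Continuous k) (hg : Continuous g) {B : ℝ}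
    (hB : ∀ b, ‖g b‖ ≤ B) (y : UnitAddCircle) :
    ‖∫ s : UnitAddCircle, k s * g (y + s)‖ ≤ (∫ s : UnitAddCircle, ‖k s‖) * B := by
  have hI : ∀ {f : UnitAddCircle → ℝ}, Continuous f → Integrable f := fun hf =>
    hf.integrable_of_hasCompactSupport (HasCompactSupport.of_compactSpace _)
  refine (norm_integral_le_integral_norm _).trans ?_
  rw [← integral_mul_const]
  refine integral_mono (hI (continuous_norm.comp (hk.mul (hg.comp (continuous_const.add continuous_id)))))
    (hI ((continuous_norm.comp hk).mul continuous_const)) fun s => ?_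
  simp only [norm_mul]
  exact mul_le_mul_of_nonneg_left (hB _) (norm_nonneg _)

/-- **The arc-character lemma.**  Let `k_ψ = Σ_{l∈S} ψ(l)e_{−l}` with `ψ` supported in `S` and `ψ(λ) = 0`; let `g` be continuous
with `|g| ≤ 1` and suppose `g(y + s) = g(y)·e_λ(s)` whenever `‖s‖ < d` (on the `d`-arc around `y`, `g` is the character `e_λ`).
Then `|∫ k_ψ(s) g(y + s) ds| ≤ 2·∫_{‖s‖ ≥ d} |k_ψ|`: the near part is `g(y)·(ψ(λ) − ∫_{‖s‖≥d} k_ψ e_λ)` by the orthogonality of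
characters, the far part is at most the tail. [cite: Grafakos2014, Prop. 3.1.2 (5) and §3.1.3] -/
theorem norm_circleCutoff_le_of_char {ψ : ℤ → ℂ} {S : Finset ℤ} {lam : ℤ} (hlam : ψ lam = 0)
    {g : UnitAddCircle → ℂ} (hg : Continuous g) (hg1 : ∀ b, ‖g b‖ ≤ 1) {d : ℝ} (y : UnitAddCircle)
    (hchar : ∀ s : UnitAddCircle, ‖s‖ < d → g (y + s) = g y * fourier lam s) :
    ‖∫ s : UnitAddCircle, (∑ l ∈ S, ψ l * fourier (-l) s) * g (y + s)‖ ≤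
      2 * ∫ s in {s : UnitAddCircle | d ≤ ‖s‖}, ‖∑ l ∈ S, ψ l * fourier (-l) s‖ := by
  classical
  set k : UnitAddCircle → ℂ := fun s => ∑ l ∈ S, ψ l * fourier (-l) s with hk
  have hkc : Continuous k := continuous_finsetSum _ fun l _ => continuous_const.mul (fourier (-l)).continuous
  have hgy : Continuous fun s : UnitAddCircle => g (y + s) := hg.comp (continuous_const.add continuous_id)
  set E : Set UnitAddCircle := {s | d ≤ ‖s‖} with hE
  have hEm : MeasurableSet E := measurableSet_le measurable_const continuous_norm.measurable
  have hI : ∀ {f : UnitAddCircle → ℂ}, Continuous f → Integrable f := fun hf =>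
    hf.integrable_of_hasCompactSupport (HasCompactSupport.of_compactSpace _)
  -- orthogonality: `∫ k e_λ = ψ(λ) = 0`
  have horth : ∫ s : UnitAddCircle, k s * fourier lam s = 0 := by
    have h1 : ∀ s : UnitAddCircle, k s * fourier lam s = ∑ l ∈ S, ψ l * ((fourier lam s : ℂ) * fourier (-l) s) := by
      intro s; rw [hk, Finset.sum_mul]; refine Finset.sum_congr rfl fun l _ => by ring
    simp_rw [h1]
    have hIl : ∀ l ∈ S, Integrable (fun s : UnitAddCircle => ψ l * ((fourier lam s : ℂ) * fourier (-l) s)) volume :=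
      fun l _ => (continuous_const.mul ((fourier lam).continuous.mul
        (fourier (-l)).continuous)).integrable_of_hasCompactSupport (HasCompactSupport.of_compactSpace _)
    rw [integral_finsetSum _ hIl]
    simp_rw [integral_const_mul, integral_fourier_mul_fourier_neg]
    by_cases hm : lam ∈ S
    · rw [Finset.sum_eq_single_of_mem lam hm fun l _ hl => by rw [if_neg (Ne.symm hl), mul_zero], if_pos rfl, mul_one, hlam]
    · exact Finset.sum_eq_zero fun l hl => by rw [if_neg (fun h : lam = l => hm (h ▸ hl)), mul_zero]
  -- split both integrals along `E` and its complement; on `Eᶜ` the integrand is `g(y)·k·e_λ`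
  have hIkg : Integrable (fun s : UnitAddCircle => k s * g (y + s)) volume := hI (hkc.mul hgy)
  have hIke : Integrable (fun s : UnitAddCircle => k s * fourier lam s) volume := hI (hkc.mul (fourier lam).continuous)
  have hsplit : ∫ s : UnitAddCircle, k s * g (y + s) =
      (∫ s in E, k s * g (y + s)) + ∫ s in Eᶜ, k s * g (y + s) :=
    (integral_add_compl hEm hIkg).symm
  have hsplit' : (0 : ℂ) = (∫ s in E, k s * fourier lam s) + ∫ s in Eᶜ, k s * fourier lam s := by
    rw [integral_add_compl hEm hIke, horth]
  have hcompl : ∫ s in Eᶜ, k s * g (y + s) = g y * ∫ s in Eᶜ, k s * fourier lam s := by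
    rw [← integral_const_mul]
    refine setIntegral_congr_fun hEm.compl fun s hs => ?_
    have hs' : ‖s‖ < d := by simpa [hE] using hs
    rw [hchar s hs']; ring
  have hkey : ∫ s : UnitAddCircle, k s * g (y + s) =
      (∫ s in E, k s * g (y + s)) - g y * ∫ s in E, k s * fourier lam s := by
    rw [hsplit, hcompl]
    have : ∫ s in Eᶜ, k s * fourier lam s = -∫ s in E, k s * fourier lam s := by
      linear_combination hsplit'.symm
    rw [this]; ring
  rw [hkey]
  -- estimate the two pieces by the tail
  have hI' : ∀ {f : UnitAddCircle → ℝ}, Continuous f → Integrable f := fun hf =>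
    hf.integrable_of_hasCompactSupport (HasCompactSupport.of_compactSpace _)
  have hA : ‖∫ s in E, k s * g (y + s)‖ ≤ ∫ s in E, ‖k s‖ := by
    refine (norm_integral_le_integral_norm _).trans ?_
    refine setIntegral_mono_on (hI' (continuous_norm.comp (hkc.mul hgy))).integrableOn
      (hI' (continuous_norm.comp hkc)).integrableOn hEm fun s _ => ?_
    rw [norm_mul]
    exact mul_le_of_le_one_right (norm_nonneg _) (hg1 _)
  have hB : ‖g y * ∫ s in E, k s * fourier lam s‖ ≤ ∫ s in E, ‖k s‖ := by
    rw [norm_mul]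
    refine (mul_le_of_le_one_left (norm_nonneg _) (hg1 y)).trans ?_
    refine (norm_integral_le_integral_norm _).trans ?_
    refine setIntegral_mono_on (hI' (continuous_norm.comp (hkc.mul (fourier lam).continuous))).integrableOn
      (hI' (continuous_norm.comp hkc)).integrableOn hEm fun s _ => ?_
    have h1 : ‖(fourier lam s : ℂ)‖ = 1 := Circle.norm_coe _
    rw [norm_mul, h1, mul_one]
  calc ‖(∫ s in E, k s * g (y + s)) - g y * ∫ s in E, k s * fourier lam s‖
      ≤ ‖∫ s in E, k s * g (y + s)‖ + ‖g y * ∫ s in E, k s * fourier lam s‖ := norm_sub_le _ _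
    _ ≤ (∫ s in E, ‖k s‖) + ∫ s in E, ‖k s‖ := add_le_add hA hB
    _ = 2 * ∫ s in E, ‖k s‖ := by ring

end Summit.AnomalousDissipation.AnomalousDissipation.Theorems.SawtoothPulseCascade.K1Window
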